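import Summits.Ventures.PercRepro.S2ElevenCaps
import Summits.Ventures.PercRepro.S2FlatSharp
import Summits.Ventures.PercRepro.S2TailFlats
import Summits.Ventures.PercRepro.S2CountsCell
import Summits.Ventures.PercRepro.S2DichotomyTools

/-!
# PercRepro — S2: THE SPREAD CASE OF THE TWICE-SCALED CELL `(11, 11)` OF `(13, 11)` AT `K₂ = 12107` (COLOOPS ALLOWED) ON THE GLOBAL CAPS (p7, gen 19; sub-claim S2; the row `p = 13`)

On a spread `e`-free core of rank `11` on `22` points (coloops allowed) (no set of nullity `4` on `≤ 9` points: the rank-`5`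
sets have `≤ 8` points, the rank-`4` sets `≤ 7`) the GLOBAL caps `24 / 250 / 2208` (`caps_eleven_eleven`; no spread cap is needed at corank `11`)
feed the kit's spread levers: the top count by `topCount_le_flat_sharp` at `(f, f′) = (8, 7)` (`#U ≤ 538538 / 3 < 179513`), the tail by flats at
`(8, 7)` (`3289774 / 15`) and the spanning count by the kit (`Σ_{m ≤ 11} C(22, m) = 2449868`): `m = 652`, the need `(1024 − 652)·64·12107/1024 = 281487.8` —
ratio `0.64`. **`c025_eleven_eleven_k2_spread`**. Nothing about the cell is claimed. Axioms: standard.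
-/

open scoped Matroid

namespace PercRepro

namespace ThmN

open Set

variable {α : Type}

/-- **The spread case of the twice-scaled cell `(11, 11)` of `(13, 11)` at `K₂ = 12107` (coloops allowed)**, on the global caps (`#U ≤ 179513`, `m = 652`). -/
theorem c025_eleven_eleven_k2_spread (M : Matroid α) [M.Finite]
    (hR : M.eRank = ((11 : ℕ) : ℕ∞)) (hn : M.E.ncard = 11 + 11)
    (hfree : ∀ e ∈ M.E, ∃ A ⊆ M.E \ {e}, e ∉ M.closure A ∧ e ∉ M.closure ((M.E \ {e}) \ A))
    (h4 : ¬ ∃ W ⊆ M.E, W.ncard ≤ 9 ∧ W.encard = M.eRk W + 4) :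
    ((phiK 13 5 - 6) / 4) * (Matroid.topCount M 11 5 : ℚ) ≤ (Matroid.midCount M 11 5 : ℚ) := by
  classical
  have hd : M.E.encard = M.eRank + ((11 : ℕ) : ℕ∞) := by
    rw [hR, ← M.ground_finite.cast_ncard_eq, hn]
    push_cast
    ring
  obtain ⟨hs3, hs4, hs5⟩ := caps_eleven_eleven M hd hfree
  have hflat : ∀ X ⊆ M.E, M.eRk X ≤ 5 → X.ncard ≤ 8 := fun X hX hr => by
    have := S2.ncard_le_of_eRk_le_of_not_nullity M 4 9 (by norm_num) h4 hX (r := 5) (by norm_num) (by exact_mod_cast hr)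
    omega
  have hflat' : ∀ X ⊆ M.E, M.eRk X ≤ 4 → X.ncard ≤ 7 := fun X hX hr => by
    have := S2.ncard_le_of_eRk_le_of_not_nullity M 4 9 (by norm_num) h4 hX (r := 4) (by norm_num) (by exact_mod_cast hr)
    omega
  have hEcard : M.ground_finite.toFinset.card = 11 + 11 := by
    rw [← Set.ncard_eq_toFinset_card _ M.ground_finite]; exact hn
  have hU := topCount_le_flat_sharp M 11 11 (by norm_num) (by norm_num) hR hn hfree 8 7 hflat hflat' (by norm_num) (by norm_num)
    24 250 2208 hs3 hs4 hs5
  have hU' : Matroid.topCount M 11 5 ≤ 179513 := by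
    have h : (Matroid.topCount M 11 5 : ℚ) ≤ 179513 := by
      refine hU.trans ?_
      norm_num [Finset.sum_range_succ, Nat.choose]
    exact_mod_cast h
  have hA := ncard_eRk_le_five_le_flats M 11 11 (by norm_num) hR hn hfree 8 7 hflat hflat' (by norm_num) (by norm_num)
    (by norm_num) (by norm_num) 24 250 2208 hs3 hs4 hs5
  have hA' : ({X : Set α | X ⊆ M.E ∧ M.eRk X ≤ 5}.ncard : ℚ) ≤ 3289774 / 15 := by
    refine hA.trans ?_
    norm_num [Finset.sum_range_succ, Nat.choose]
  have hS' : {X : Set α | X ⊆ M.E ∧ M.eRk X = M.eRank}.ncard ≤ 2449868 := by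
    have hS := Matroid.ncard_spanning_le (M := M) hd
    rw [hEcard] at hS
    exact hS.trans (by decide)
  exact c025_core_five_cell_of_counts_xqictq5g M 11 11 (by norm_num) hR hn 179513 hU' _ hA' 2449868 hS'
    12107 (by norm_num) ((phiK 13 5 - 6) / 4) (by rw [phiK_thirteen_five]; norm_num) ⟨652, by norm_num, by norm_num, by norm_num⟩

end ThmN

end PercRepro
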